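import Mathlib
import HarnessLib
import HarnessLib.Audit
import Summits.MatrixMultiplication.Statement
import Literature.Combinatorics.Additive.TripleProductProperty

/-!
Route: HenselBoxCollapse

CLOSED (retired) 2026-08-15T13:48:54Z by operator:999:1257524 — reason: not-a-thesis: assembly does not conclude the sub-problem Statement — note: D-0027 §2.1 audit (human 2026-08-15: routes that do not decide the summit are removed): the assembly concludes `AnalyticBoxBarrier`, not the sub-problem statement; a NEW conforming route may be opened from the same idea (generated `closes : … → _root_.MatrixMultiplication`).. The file is kept as the record of this route; refuted decls are indexed as negative knowledge (`ledger negatives`).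

# Route HenselBoxCollapse — Hensel destroys what Archimedes saves — analytic (box-like) TPP designs
collapse in congruence towers; barrier route with the tower packing question as crux

BARRIER ROUTE (D-0021 negative knowledge), realising idea card nonarchimedean-lie-tpp-collapse with
the planner's corrections. It is declared up front that X does NOT imply
Summit.MatrixMultiplication.MatrixMultiplication (nor its negation) and is not claimed to: X is a
no-go theorem for a technique class (Cohn–Umans TPP designs in congruence quotients G_k = 𝒢(ℤ/p^k)
of a p-adic analytic group obtained by reducing analytic, i.e. locally box-like, subsets), provable
now from Mathlib + the tree's `TripleProductProperty`; the Assembly is the glue BoxToAbelianTransfer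
→ AbelianTPPCapacity → X and the deliverable is a Theorems file a literature seat can vendor as
Literature/Barriers/MatrixMultiplication/CongruenceBoxBarrier. X (ANALYTIC BOX BARRIER, "it suffices
to show"): let R = ℤ/p^k and m < k ≤ 2m, so π := p^m has π² = 0 in R and the congruence layer K_m =
1 + π·M_n(R) ◁ GL_n(R) is ABELIAN (≅ (M_n(ℤ/p^(k−m)), +)); a first-order box is g·(1 + π·D(R^a))
with g ∈ GL_n(R) and D : R^a → M_n(R) linear — this is exactly what the image mod p^k of an
a-dimensional p-adic analytic submanifold through g looks like inside one residue class mod p^m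
(Taylor to first order at scale p^m, valid since 2m ≥ k). CLAIM: if (S, T, U) has the triple product
property and S, T, U lie in first-order boxes whose conjugated tangent modules g_i D_i(·) g_i⁻¹ sit
inside a d-generated submodule L ≤ M_n(R) (L = Lie algebra of the ambient d-dimensional group mod
p^k), then |S||T||U| ≤ p^((k−m)d) = |π L|-bound. Consequences (support items / remarks): (i) FULL
boxes of ranks a, b, c are never TPP once a + b + c > d — the discretised p-adic analogue of
BlasiakCohnGrochowPrattUmans2023 Thm 4.7 (over algebraically closed fields dim V₁+dim V₂+dim V₃ ≤
dim G), which over ℝ FAILS (CohnUmans2003, arXiv:math/0307321 text Thm 12: (U⁺, U⁻, SO_n) in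
SL_n(ℝ), and BCGPU23 Thm 4.10, meet the packing bound thanks to definiteness) — "Hensel destroys
what Archimedes saves": mod p^k the anisotropy that isolates a rational point is invisible above
valuation k/2; (ii) sub-designs inside analytic images of total dimension a+b+c have capacity ≤
p^(m(a+b+c)+(k−m)d), i.e. exponent ≤ ((a+b+c)/d + 1)/2 of |G_k| at m = k/2, so meeting the packing
bound (3/2) inside analytic charts needs FAT charts a+b+c ≥ 2d: analyticity buys nothing and any
viable p-adic design must be digit-restricted at ≥ half of the scales. The two CRUXES are the honest
open extensions the card gestured at ("no bound ω < 3 survives"): TowerPackingFailure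
(fixed-dimension unipotent congruence towers U_n(ℤ/p^k), k → ∞, never meet the packing bound — a
proof is a catalogue-grade barrier closing the congruence-tower host programme of the sibling cards
unipotent-congruence-towers / automatic-stpp-designs-buchi; a refutation is a packing family in
unbarred territory) and TowerCapacityOne (the card's literal collapse claim: TPP capacity exponent 1
+ o(1) along the tower; probably false, filed as refuter bait with a cheap computational falsifier).
Lean: `∀ (p k m n a b c d : ℕ), Nat.Prime p → m < k → k ≤ 2 * m → ∀ (g₁ g₂ g₃ :
Matrix.GeneralLinearGroup (Fin n) (ZMod (p ^ k))) (D₁ : (Fin a → ZMod (p ^ k)) →ₗ[ZMod (p ^ k)]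
Matrix (Fin n) (Fin n) (ZMod (p ^ k))) (D₂ : (Fin b → ZMod (p ^ k)) →ₗ[ZMod (p ^ k)] Matrix (Fin n)
(Fin n) (ZMod (p ^ k))) (D₃ : (Fin c → ZMod (p ^ k)) →ₗ[ZMod (p ^ k)] Matrix (Fin n) (Fin n) (ZMod
(p ^ k))) (gen : Fin d → Matrix (Fin n) (Fin n) (ZMod (p ^ k))), (∀ x, (g₁.val * D₁ x * g₁⁻¹.val :
Matrix (Fin n) (Fin n) (ZMod (p ^ k))) ∈ Submodule.span (ZMod (p ^ k)) (Set.range gen)) → (∀ y,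
(g₂.val * D₂ y * g₂⁻¹.val : Matrix (Fin n) (Fin n) (ZMod (p ^ k))) ∈ Submodule.span (ZMod (p ^ k))
(Set.range gen)) → (∀ z, (g₃.val * D₃ z * g₃⁻¹.val : Matrix (Fin n) (Fin n) (ZMod (p ^ k))) ∈
Submodule.span (ZMod (p ^ k)) (Set.range gen)) → ∀ (S T U : Finset (Matrix.GeneralLinearGroup (Fin
n) (ZMod (p ^ k)))), (∀ s ∈ S, ∃ x, (s : Matrix (Fin n) (Fin n) (ZMod (p ^ k))) = g₁.val * (1 + ((p
: ZMod (p ^ k)) ^ m) • D₁ x)) → (∀ t ∈ T, ∃ y, (t : Matrix (Fin n) (Fin n) (ZMod (p ^ k))) = g₂.val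
* (1 + ((p : ZMod (p ^ k)) ^ m) • D₂ y)) → (∀ u ∈ U, ∃ z, (u : Matrix (Fin n) (Fin n) (ZMod (p ^
k))) = g₃.val * (1 + ((p : ZMod (p ^ k)) ^ m) • D₃ z)) →
Literature.Combinatorics.Additive.TripleProductProperty S T U → S.card * T.card * U.card ≤ p ^ ((k -
m) * d)`

## Assembly
Barrier route: the conclusion of the Assembly is the barrier X = AnalyticBoxBarrier, NOT the summit
(declared in § Thesis; precedent route-AnomalousDissipation-TaylorResolutionBarrier). Glue
(elementary): BoxToAbelianTransfer gives S', T', U' ⊆ πL-cosets... precisely S' ⊆ π·g₁D₁(R^a)g₁⁻¹ ⊆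
πL etc. with the additive TPP and the same cardinalities; take V = image of (r : Fin d → R) ↦ Σᵢ (π
rᵢ)•genᵢ, which contains S'+T'+U' (Submodule.mem_span_range_iff_exists_fun) and has |V| ≤ |πR|^d =
p^((k−m)d); AbelianTPPCapacity finishes. The two cruxes are NOT in the chain (negative-knowledge
extensions, staffed on both sides, like NilCoxeterShadow.PolynomialExcess).

Rationale: WHY THIS LINE. Mechanism: for m < k ≤ 2m the top congruence layer K_m/K_k of any matrix group over
ℤ/p^k is abelian ((1+π A)(1+π B) = 1 + π(A+B), π = p^m; DDMS doi:10.1017/cbo9780511470882 §5.1,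
Lemma 5.1/Thm 5.2 for the filtration), TPP is invariant under independent right translation of the
three sets (Neumann2011 Obs 2.1), so a TPP sub-triple of three first-order boxes is a TPP triple
inside the abelian group (π L, +), where the product map is injective (CohnUmans2003 Lemma 3.1;
Murthy arXiv:2602.15796 Thm 2.3) — capacity ≤ |π L| ≤ p^((k−m)d). This is Neumann2011 Obs 4.1/Cor
4.2 (β(G) ≤ v²|G| from an abelian subgroup of index v) LOCALISED to one coset with tangent
constraints, which is what turns a globally vacuous bound into the dimension inequality a+b+c ≤ d
for analytic data. Imported areas: p-adic analytic groups / uniform pro-p filtrations (DDMS), TPP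
capacity β, ρ of finite groups (Neumann2011, HedtkeMurthy2012, Hedtke2011, arXiv:2602.15796), the
Lie-group programme BlasiakCohnGrochowPrattUmans2023 §4 + arXiv:2410.14905 whose §4 open bullet
"other infinite groups (not necessarily Lie groups)" this line answers for the naive p-adic
transposition. What it does that prior routes / the card do not: GroupTheoreticSTPP (abelian STPP,
rank-4 non-abelian TPP families) has no p-adic/congruence statement; the card's Claim 1 is proved
here by a two-line abelian argument instead of a Hensel cascade, its Claim 2 (total collapse of all
sub-triples) is exposed as the unproved conjecture TowerCapacityOne (for M_i = G it asserts
pseudo-exponent → 3 along every tower), and its Kneser pillar is corrected: p-adic Lie-level excess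
EXISTS in bounded rank ((U⁺, U⁻, SO(q)) in SL₄(ℚ_p), q an anisotropic quaternary form: 6+6+6 = 18 >
15, by the CU03 unit-vector induction run with anisotropic ternary/binary subforms; up to SL₅), so
the destruction is a DISCRETISATION phenomenon, not a statement about ℚ_p-manifolds. Negatives
index: empty for this summit at filing.

RANKED CRUXES. #0 AnalyticBoxBarrier (target) — X as in § Thesis: for p prime, m < k ≤ 2m, boxes
gᵢ(1 + p^m Dᵢ(R^aᵢ)) in GL_n(ℤ/p^k) with conjugated tangents inside a d-generated submodule L, every
TPP sub-triple (S ⊆ box₁, T ⊆ box₂, U ⊆ box₃) has |S||T||U| ≤ p^((k−m)d). (why it might fail: Only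
by misformalisation: needs π² = 0 (k ≤ 2m, so K_m is abelian) and |πL| ≤ |πR|^d for a d-GENERATED
(not free) L; a wrong inequality direction in the box hypothesis (⊇ instead of ⊆) would make it
false.) [CohnUmans2003, Neumann2011, doi:10.1017/cbo9780511470882, BlasiakCohnGrochowPrattUmans2023,
arXiv:2602.15796]
#2 TowerPackingFailure (crux) — for every prime p and every n there is c = c(p, n) > 0 such that for
all k, every TPP triple (S, T, U) of upper unitriangular matrices in GL_n(ℤ/p^k) (i.e. inside
U_n(ℤ/p^k), |U_n(ℤ/p^k)| = p^(k·n(n−1)/2)) has |S||T||U| ≤ p^(k·n(n−1)/2·(3/2 − c)): fixed-dimension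
unipotent congruence towers never meet the packing bound (BCGPU23 Def 2.3), hence (CU03 Thm 4.1 /
CKSU05 Cor 1.9 bookkeeping) cannot give ω = 2 by single TPP. NEGATIVE knowledge; both sides staffed:
its negation is the construction crux (3) of card unipotent-congruence-towers. [difficulty:
open-problem] (why it might fail: May be false: digit-restricted carry-aware designs (card
unipotent-congruence-towers) or any window K_j/K_cj with k-uniform capacity gain would stack to a
packing family; only the abelian top window is controlled; slice rank is powerless at unbounded
exponent (BCCGU17 Ex 3.14, Thm B.8).) [BlasiakChurchCohnGrochowUmans2017,
BlasiakCohnGrochowPrattUmans2023, CohnUmans2003, arXiv:2602.15796, Neumann2011, arXiv:2410.14905]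
#3 TowerCapacityOne (crux) — the card's literal collapse claim made honest: for every prime p, every
n and every ε > 0 there is k₀ such that for k ≥ k₀ every TPP triple inside U_n(ℤ/p^k) has |S||T||U|
≤ p^(k·n(n−1)/2·(1+ε)) — TPP capacity β(U_n(ℤ/p^k)) = |U_n(ℤ/p^k)|^(1+o(1)), pseudo-exponent → 3
along the tower ("NO bound ω < 3 survives"). Refuter bait: a k-uniform family with capacity exponent
1 + η refutes it and is the first milestone of the sibling programme. [difficulty: L] (why it might
fail: Probably false: CU03 (arXiv-text Cor 15) gives capacity |G|^(6/5) at level k = 1 (extraspecial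
p^5, anisotropic form), Murthy 2026 Thm 3.1 allows subgroup ratio up to √|G:Z| in class 2, and any
k-uniform window gain η > 0 stacks geometrically to exponent 1 + η.) [CohnUmans2003,
arXiv:2602.15796, Neumann2011, HedtkeMurthy2012, Hedtke2011, BlasiakChurchCohnGrochowUmans2017]
#9 BoxToAbelianTransfer (support) — (glue, provable now) under m < k ≤ 2m, a TPP triple (S, T, U)
with S ⊆ g₁(1+p^m D₁(R^a)), T ⊆ g₂(1+p^m D₂(R^b)), U ⊆ g₃(1+p^m D₃(R^c)) yields Finsets S', T', U' ⊆
M_n(ℤ/p^k) of the same cardinalities, S' ⊆ p^m·g₁D₁(R^a)g₁⁻¹ etc., with the ADDITIVE triple product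
property (right-translate each set by gᵢ⁻¹ — Neumann2011 Obs 2.1 — then s gᵢ⁻¹ = 1 + σ with σσ' = 0,
so (1+σ)(1+σ')⁻¹ = 1 + σ − σ' and the six-fold product is 1 + Σ(σ−σ')). [difficulty: provable-now]
[Neumann2011, doi:10.1017/cbo9780511470882, CohnUmans2003]
#9 AbelianTPPCapacity (support) — (CohnUmans2003 Lemma 3.1, additive Finset form, provable now) in
an abelian group an additive TPP triple has injective sum map: if s + t + u ∈ V for all s ∈ S, t ∈
T, u ∈ U then |S||T||U| ≤ |V|. [difficulty: provable-now] [CohnUmans2003, arXiv:2602.15796,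
Neumann2011]
#9 FullBoxCollapse (support) — (the card's "collapse lemma", provable now from the target) with
injective Dᵢ and FULL boxes gᵢ(1 + p^m Dᵢ(R^aᵢ)) ⊆ S, T, U (sizes p^((k−m)aᵢ)), TPP forces a + b + c
≤ d: reductions mod p^k (k ≥ 2) of p-adic analytic TPP submanifolds of a d-dimensional group can
stay TPP only if their conjugated tangent spaces are independent — no excess, unlike ℝ (CU03
arXiv-text Thm 12 / BCGPU23 Thm 4.10) and unlike ℚ_p itself ((U⁺,U⁻,SO(q)) ⊂ SL₄(ℚ_p)). [difficulty:
provable-now] [BlasiakCohnGrochowPrattUmans2023, CohnUmans2003, arXiv:2410.14905]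

TWO-LAYER PLAN. Foreseen glued splits (nothing filed now): TowerPackingFailure ⇐ WindowNoGain (no
fixed-ratio window quotient K_j∩U_n / K_cj∩U_n has k-uniform capacity exponent > 1) → WindowStacking
(CU03 arXiv-text Lemma 5, α(G) ≤ max(α(N), α(G/N)), read in reverse: a packing family forces a
gaining window) → TowerPackingFailure; TowerCapacityOne ⇐ the class-2 window (K_j/K_3j,
Heisenberg-like, where arXiv:2602.15796 Thm 3.1 and Neumann2011 Cor 4.2 start) → general. On the Lie
level (informal, untypable in Mathlib today, filed only if a crux closes): PadicSubgroupExcess — TPP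
triples of connected algebraic ℚ_p-subgroups of GL_N have Σ dim ≤ N² + O(N) (Kneser/Bruhat–Tits:
anisotropic ℚ_p-subgroups of SL_N have dimension ≤ N − 1, PlatonovRapinchuk1994 Ch. 6), versus
(3/2)·dim over ℝ.

KILL CRITERIA. TowerPackingFailure REFUTED (an explicit k-uniform packing-meeting TPP family in some
U_n(ℤ/p^k)) ⇒ close `refuted:TowerPackingFailure` — and this is good news for the summit: hand the
family to GroupTheoreticSTPP.CNonabelianTPPFamilies together with the orbit-method degree bound
d_max(U_n(ℤ/p^k)) = |G|^(1/2 − c_n) of card unipotent-congruence-towers (a positive route opens).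
TowerCapacityOne refuted ⇒ expected: drop it (not load-bearing), record the family's exponent 1 + η
as the tower's first milestone, keep the route on TowerPackingFailure. AnalyticBoxBarrier refuted ⇒
planner error in the box/π² bookkeeping: restate at once (the mathematics is a two-line abelian
argument). Both cruxes PROVED ⇒ route completed: vendor CongruenceTowerBarrier into
Literature/Barriers/MatrixMultiplication and retire the sibling p-adic host cards. A proof of ω = 2
elsewhere moots nothing here (barrier knowledge stays valid) but ends staffing.

NOT DECOMPOSED YET. The multiscale ("cascade") version of the box barrier below the top scale —
deliberately NOT filed: near-solutions of valuation < k/2 are not solutions, Hensel lifting needs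
the transversality that anisotropy-based designs lack by construction, and TPP does not descend to
quotients G_k → G_m, so no recursion over scales is claimed; the GL_n / general smooth group-scheme
versions of the two cruxes (U_n chosen: it is the live host of the sibling cards and contains no
symmetric or Lie-type subgroups); the STPP (simultaneous) analogue of the box barrier (same
abelian-layer argument with SimultaneousTPP.sum_card_mul_card_le; file when GroupTheoreticSTPP
asks); the Lie-level PadicSubgroupExcess statement (needs algebraic groups over ℚ_p in Mathlib);
representation-theoretic accounting (d_max of U_n(ℤ/p^k)) — belongs to the positive sibling line,
not to this barrier.

CHEAPEST FALSIFIER. For the cruxes: an exhaustive TPP-capacity computation β(U₃(ℤ/p^k)) for (p,k) ∈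
{(2,2),(2,3),(3,2)} (orders 64, 512, 729; HedtkeMurthy2012-style search, `kit compute`) compared
with |G| and |G|^(3/2): a ratio log β/log|G| clearly increasing with k at fixed p would sink
TowerCapacityOne at once and calibrate c in TowerPackingFailure; the planner could not run kit in
this seat (compute is refuter/prover-side here). For the target: brute force over all sub-triples of
three first-order boxes in GL₂(ℤ/4) (K₁ ≅ (M₂(𝔽₂),+), 16 elements) — any TPP sub-triple with
|S||T||U| > |πL| kills X; by the abelian argument none exists. Literature check already run:
Neumann2011 Cor 4.2 / arXiv:2602.15796 Thm 3.1 are consistent with (and weaker than) both cruxes on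
their domains.

NUMBERS. β(G) < |G|^(3/2) always (CohnUmans2003 pf of Lemma 3.1; Neumann2011 Cor 3.2: β(G) ≤
((1+√(1+8|G|))/4)³ ≈ (|G|/2)^(3/2)); abelian G: β(G) = |G| (CU03 Lemma 3.1 = arXiv:2602.15796 Thm
2.3); abelian subgroup of index v: β(G) ≤ v²|G| (Neumann2011 Cor 4.2 — for G_k = 𝒢(ℤ/p^k) with the
abelian layer K_⌈k/2⌉ of index ≈ |G_k|^(1/2) this is the vacuous β ≤ |G_k|²; the target is its
localisation); class-2 subgroup ratio ρ₀(G) < √|G:Z(G)| (arXiv:2602.15796 Thm 3.1),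
extraspecial/cyclic-commutator ρ₀ ≤ p (ibid. (4)); level-one gain: the extraspecial group of order
q^5 built from an anisotropic binary form realizes ⟨q²,q²,q²⟩, pseudo-exponent 2.5, capacity
|G|^(6/5) (CohnUmans2003, arXiv:math/0307321 text Prop 13/Cor 15, solvable-groups subsection) — and
its naive lift to ℤ/p^k collapses to capacity exactly |G| (the null cone mod p^k is {v_p(z) ≥ k/2},
so the third set must inject mod p^⌈k/2⌉): the slogan in its smallest instance; congruence
filtration: |Γ₁:Γᵢ| = p^(d²(i−1)) in GL_d(ℤ_p), Γ_m/Γ_2m abelian (doi:10.1017/cbo9780511470882 §5.1,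
Thm 5.2); real side: (U⁺,U⁻,SO_n) ⊂ SL_n(ℝ) has Σ dim = 3n(n−1)/2 = (3/2)(dim G) − O(n)
(CohnUmans2003, arXiv-text Thm 12; BCGPU23 Thm 4.9/4.10), complex/algebraically-closed side Σ dim ≤
dim G (BCGPU23 Thm 4.7); planner's p-adic examples (to be checked by refuters): (U⁺,U⁻,SO(q)) TPP in
SL₄(ℚ_p) with excess 3 and in SL₅(ℚ_p) with excess 6 for q ⊇ an anisotropic quaternary diagonal
form; anisotropic ℚ_p-subgroups of SL_N have dim ≤ N − 1 (Kneser; PlatonovRapinchuk1994 Ch. 6).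
Items at open: 7 (1 target, 2 cruxes, 3 support, 1 assembly).

DEFINITION REQUESTS. None: `Literature.Combinatorics.Additive.TripleProductProperty` /
`AddTripleProductProperty` (CU03 Def 2.1, Finset form) exist and are used verbatim; everything else
is Mathlib (Matrix.GeneralLinearGroup, ZMod, Submodule.span). Bib entries for DDMS
(doi:10.1017/cbo9780511470882), Murthy 2026 (arXiv:2602.15796) and BCGPU 2025 (arXiv:2410.14905)
were prepared (folder new.bib) but `ledger bib add` timed out twice this session; sources cite them
by doi/arXiv id.

Novelty: Searches (2026-08-15; searchd local index DOWN — ConnectionReset; arXiv/OpenAlex HTTP 429; zbMATH 0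
rows for "triple product property matrix multiplication p-groups"): `lit search --source s2 "triple
product property nilpotent group matrix multiplication"` (15 rows: arXiv:2602.15796 Murthy 2026,
Neumann2011, HedtkeMurthy2012 = arXiv:1104.5097, Hedtke2011 = arXiv:1107.5969, arXiv:2410.14905,
TPP-search heuristics papers); `lit galaxy search "triple product property" --star all` (13 rows:
Sawin arXiv:1702.00905, BCGPU25 LIPIcs, CKSU05, Landsberg's book; nothing p-adic); `lit galaxy
search "pseudo-exponent" --star pdf` (queue timeout); full reads: arXiv:2204.03826 §4 (Def 4.1, Prop
4.3–4.6, Thm 4.7, Lemma 4.8, Thm 4.9, Thm 4.10, Rem 4.11, §5), arXiv:math/0307321 (Lemma 3.1/3.2 =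
arXiv Lemmas 4–5, Thm 6, Thm 12 with the SO_n(ℂ)/finite-field failure remark "a sum of non-zero
squares may vanish", Prop 13, Cor 14–15, Prop 16, §7 questions "Do results on the Lie
pseudo-exponent imply anything about the pseudo-exponents of related finite groups?"),
arXiv:2602.15796 (defs β, ρ, β₀, ρ₀; Thm 2.3; Thm 3.1), Neumann2011 (Obs 2.1, Cor 3.2, Obs 4.1, Cor
4.2), DDMS §5.1 (Lemma 5.1, Thm 5.2), the card's own audit (grep of 2204.03826/2410.14905 for
p-adic|profinite|anisotrop = 0). `lit frontier` / `lit bridges` not re-run (searchd down);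
GroupTheoreticSTPP's retriage ran them 2026-08-15 with no p-adic hit.
Nearest prior art found: Neumann2011 Obs 4.1/Cor 4.2 (right-translate and intersect with  [refs: 2602.15796, 1104.5097, 1107.5969, 2410.14905, 1702.00905, 2204.03826, math/0307321, Neumann2011, HedtkeMurthy2012, Hedtke2011, CohnUmans2003, BlasiakCohnGrochowPrattUmans2023, BlasiakChurchCohnGrochowUmans2017]

Barriers (technique_class: barrier, TPP capacity, p-adic congruence towers): - technique_class: barrier, TPP capacity, p-adic congruence towers
- Literature.Barriers.MatrixMultiplication.NilpotentGroupBarrier: does not cover the line's objects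
— BCCGU17 Cor 3.20 / Sawin Thm 1.5 need bounded exponent and class (or powers of a fixed group),
while U_n(ℤ/p^k), k → ∞, has exponent p^(k+O(1)) and the STPP loophole "(ℤ/p^k)^m with k growing is
not ruled out" (Ex 3.14) is exactly the territory; TowerPackingFailure, if proved, EXTENDS this
barrier to unbounded exponent in fixed dimension; slice rank cannot prove it (cyclic groups have
full slice rank, Thm B.8).
- Literature.Barriers.MatrixMultiplication.QuasirandomBarrier: toothless here and not relied on —
n(GL_n(ℤ/p^k)) and n(U_n(ℤ/p^k)) are p^(O(n)) = |G_k|^(O(1/k)) → |G|^(o(1)) as k → ∞ (BCGPU23 Thm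
3.2 needs n(G) ≥ |G|^δ); this is why congruence towers are attractive to the sibling cards and why a
separate barrier is needed.
- Literature.Barriers.MatrixMultiplication.NormalizerBarrier: subgroup triples with large
normalisers only (BCGPU23 Thm 3.6/Cor 3.8); the target and both cruxes quantify over arbitrary
subsets; consistent (the centre of U_n(ℤ/p^k) has size p^k = |G|^(2/(n(n−1))), an o(1) loss for
large n, so the normaliser barrier alone does not decide TowerPackingFailure).
- Literature.Barriers.MatrixMultiplication.TricoloredSumFreeBarrier: abelian bounded-exponent STPP
only; the line is single-TPP in non-abelian towers; n/a except as the model of what a tower barrier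
proof cannot use.
- Literature.B

History (route lifecycle, newest last):
- 2026-08-15T13:48:54Z · CLOSED retired — not-a-thesis: assembly does not conclude the sub-problem Statement (operator:999:1257524)

sub-problem: MatrixMultiplication · status: closed(retired) · opened planner-plancard-MatrixMultiplication-MatrixM-cceef64f-0 2026-08-15T11:53:06Z · rev 0 · ledger route-MatrixMultiplication-HenselBoxCollapse
GENERATED by the gate from the ledger (D-0016/17). Provers cite these decls: `theorem foo : Summit.MatrixMultiplication.MatrixMultiplication.Theses.HenselBoxCollapse.<Decl> := …` in Summits/MatrixMultiplication/MatrixMultiplication/Theorems/<Name>.lean.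
-/

namespace Summit.MatrixMultiplication.MatrixMultiplication.Theses.HenselBoxCollapse

open scoped BigOperators Topology Manifold Classical MeasureTheory ProbabilityTheory Matrix InnerProductSpace ComplexConjugate ContinuousMap
open Filter Set Function TopologicalSpace MeasureTheory

attribute [summit_statement] _root_.MatrixMultiplication

/-- item stmt-MatrixMultiplication-6813 · target · rank 0 · closed · moot by None · by planner
why it might fail: Only by misformalisation: needs π² = 0 (k ≤ 2m, so K_m is abelian) and |πL| ≤ |πR|^d for a d-GENERATED (not free) L; a wrong inequality direction in the box hypothesis (⊇ instead of ⊆) would make it false.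
sources: CohnUmans2003, Neumann2011, doi:10.1017/cbo9780511470882, BlasiakCohnGrochowPrattUmans2023, arXiv:2602.15796
[target] X as in § Thesis: for p prime, m < k ≤ 2m, boxes gᵢ(1 + p^m Dᵢ(R^aᵢ)) in GL_n(ℤ/p^k) with
conjugated tangents inside a d-generated submodule L, every TPP sub-triple (S ⊆ box₁, T ⊆ box₂, U ⊆
box₃) has |S||T||U| ≤ p^((k−m)d). -/
@[route_item "route-MatrixMultiplication-HenselBoxCollapse"]
def AnalyticBoxBarrier : Prop :=
  ∀ (p k m n a b c d : ℕ), Nat.Prime p → m < k → k ≤ 2 * m → ∀ (g₁ g₂ g₃ : Matrix.GeneralLinearGroup (Fin n) (ZMod (p ^ k))) (D₁ : (Fin a → ZMod (p ^ k)) →ₗ[ZMod (p ^ k)] Matrix (Fin n) (Fin n) (ZMod (p ^ k))) (D₂ : (Fin b → ZMod (p ^ k)) →ₗ[ZMod (p ^ k)] Matrix (Fin n) (Fin n) (ZMod (p ^ k))) (D₃ : (Fin c → ZMod (p ^ k)) →ₗ[ZMod (p ^ k)] Matrix (Fin n) (Fin n) (ZMod (p ^ k))) (gen : Fin d → Matrix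 (Fin n) (Fin n) (ZMod (p ^ k))), (∀ x, (g₁.val * D₁ x * g₁⁻¹.val : Matrix (Fin n) (Fin n) (ZMod (p ^ k))) ∈ Submodule.span (ZMod (p ^ k)) (Set.range gen)) → (∀ y, (g₂.val * D₂ y * g₂⁻¹.val : Matrix (Fin n) (Fin n) (ZMod (p ^ k))) ∈ Submodule.span (ZMod (p ^ k)) (Set.range gen)) → (∀ z, (g₃.val * D₃ z * g₃⁻¹.val : Matrix (Fin n) (Fin n) (ZMod (p ^ k))) ∈ Submodule.span (ZMod (p ^ k)) (Set.range gen)) → ∀ (S T U : Finset (Matrix.GeneralLinearGroup (Fin n) (ZMod (p ^ k)))), (∀ s ∈ S, ∃ x, (s : Matrix (Fin n) (Fin n) (ZMod (p ^ k))) = g₁.val * (1 + ((p : ZMod (p ^ k)) ^ m) • D₁ x)) → (∀ t ∈ T, ∃ y, (t : Matrix (Fin n) (Fin n) (ZMod (p ^ k))) = g₂.val * (1 + ((p : ZMod (p ^ k)) ^ m) • D₂ y)) → (∀ u ∈ U, ∃ z, (u : Matrix (Fin n) (Fin n) (ZMod (p ^ k))) = g₃.val * (1 + ((p : ZMod (p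 ^ k)) ^ m) • D₃ z)) → Literature.Combinatorics.Additive.TripleProductProperty S T U → S.card * T.card * U.card ≤ p ^ ((k - m) * d)

/-- item stmt-MatrixMultiplication-6814 · crux · rank 2 · closed · moot by None · by planner
why it might fail: May be false: digit-restricted carry-aware designs (card unipotent-congruence-towers) or any window K_j/K_cj with k-uniform capacity gain would stack to a packing family; only the abelian top window is controlled; slice rank is powerless at unbounded exponent (BCCGU17 Ex 3.14, Thm B.8).
sources: BlasiakChurchCohnGrochowUmans2017, BlasiakCohnGrochowPrattUmans2023, CohnUmans2003, arXiv:2602.15796, Neumann2011, arXiv:2410.14905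
[crux] for every prime p and every n there is c = c(p, n) > 0 such that for all k, every TPP triple
(S, T, U) of upper unitriangular matrices in GL_n(ℤ/p^k) (i.e. inside U_n(ℤ/p^k), |U_n(ℤ/p^k)| =
p^(k·n(n−1)/2)) has |S||T||U| ≤ p^(k·n(n−1)/2·(3/2 − c)): fixed-dimension unipotent congruence
towers never meet the packing bound (BCGPU23 Def 2.3), hence (CU03 Thm 4.1 / CKSU05 Cor 1.9
bookkeeping) cannot give ω = 2 by single TPP. NEGATIVE knowledge; both sides staffed: its negation
is the construction crux (3) of card unipotent-congruence-towers. [difficulty: open-problem] -/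
@[route_item "route-MatrixMultiplication-HenselBoxCollapse"]
def TowerPackingFailure : Prop :=
  ∀ (p n : ℕ), Nat.Prime p → ∃ c : ℝ, 0 < c ∧ ∀ (k : ℕ) (S T U : Finset (Matrix.GeneralLinearGroup (Fin n) (ZMod (p ^ k)))), (∀ s ∈ S, ∀ i j : Fin n, (i = j → (s : Matrix (Fin n) (Fin n) (ZMod (p ^ k))) i j = 1) ∧ (j < i → (s : Matrix (Fin n) (Fin n) (ZMod (p ^ k))) i j = 0)) → (∀ t ∈ T, ∀ i j : Fin n, (i = j → (t : Matrix (Fin n) (Fin n) (ZMod (p ^ k))) i j = 1) ∧ (j < i → (t : Matrix (Fin n) (Fin n) (ZMod (p ^ k))) i j = 0)) → (∀ u ∈ U, ∀ i j : Fin n, (i = j → (u : Matrix (Fin n) (Fin n) (ZMod (p ^ k))) i j = 1) ∧ (j < i → (u : Matrix (Fin n) (Fin n) (ZMod (p ^ k))) i j = 0)) → Literature.Combinatorics.Additive.TripleProductProperty S T U → ((S.card * T.card * U.card : ℕ) : ℝ) ≤ (p : ℝ) ^ ((k : ℝ) * ((n : ℝ) * ((n : ℝ) - 1) / 2) * (3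 / 2 - c))

/-- item stmt-MatrixMultiplication-6815 · crux · rank 3 · closed · moot by None · by planner
why it might fail: Probably false: CU03 (arXiv-text Cor 15) gives capacity |G|^(6/5) at level k = 1 (extraspecial p^5, anisotropic form), Murthy 2026 Thm 3.1 allows subgroup ratio up to √|G:Z| in class 2, and any k-uniform window gain η > 0 stacks geometrically to exponent 1 + η.
sources: CohnUmans2003, arXiv:2602.15796, Neumann2011, HedtkeMurthy2012, Hedtke2011, BlasiakChurchCohnGrochowUmans2017
[crux] the card's literal collapse claim made honest: for every prime p, every n and every ε > 0
there is k₀ such that for k ≥ k₀ every TPP triple inside U_n(ℤ/p^k) has |S||T||U| ≤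
p^(k·n(n−1)/2·(1+ε)) — TPP capacity β(U_n(ℤ/p^k)) = |U_n(ℤ/p^k)|^(1+o(1)), pseudo-exponent → 3 along
the tower ("NO bound ω < 3 survives"). Refuter bait: a k-uniform family with capacity exponent 1 + η
refutes it and is the first milestone of the sibling programme. [difficulty: L] -/
@[route_item "route-MatrixMultiplication-HenselBoxCollapse"]
def TowerCapacityOne : Prop :=
  ∀ (p n : ℕ), Nat.Prime p → ∀ ε : ℝ, 0 < ε → ∃ k₀ : ℕ, ∀ (k : ℕ), k₀ ≤ k → ∀ (S T U : Finset (Matrix.GeneralLinearGroup (Fin n) (ZMod (p ^ k)))), (∀ s ∈ S, ∀ i j : Fin n, (i = j → (s : Matrix (Fin n) (Fin n) (ZMod (p ^ k))) i j = 1) ∧ (j < i → (s : Matrix (Fin n) (Fin n) (ZMod (p ^ k))) i j = 0)) → (∀ t ∈ T, ∀ i j : Fin n, (i = j → (t : Matrix (Fin n) (Fin n) (ZMod (p ^ k))) i j = 1) ∧ (j < i → (t : Matrix (Fin n) (Fin n) (ZMod (p ^ k))) i j = 0)) → (∀ u ∈ U, ∀ i j : Fin n, (i = j → (u : Matrix (Fin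 n) (Fin n) (ZMod (p ^ k))) i j = 1) ∧ (j < i → (u : Matrix (Fin n) (Fin n) (ZMod (p ^ k))) i j = 0)) → Literature.Combinatorics.Additive.TripleProductProperty S T U → ((S.card * T.card * U.card : ℕ) : ℝ) ≤ (p : ℝ) ^ ((k : ℝ) * ((n : ℝ) * ((n : ℝ) - 1) / 2) * (1 + ε))

/-- item stmt-MatrixMultiplication-6816 · support · rank 9 · closed · moot by None · by planner
sources: Neumann2011, doi:10.1017/cbo9780511470882, CohnUmans2003
[support] (glue, provable now) under m < k ≤ 2m, a TPP triple (S, T, U) with S ⊆ g₁(1+p^m D₁(R^a)),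
T ⊆ g₂(1+p^m D₂(R^b)), U ⊆ g₃(1+p^m D₃(R^c)) yields Finsets S', T', U' ⊆ M_n(ℤ/p^k) of the same
cardinalities, S' ⊆ p^m·g₁D₁(R^a)g₁⁻¹ etc., with the ADDITIVE triple product property
(right-translate each set by gᵢ⁻¹ — Neumann2011 Obs 2.1 — then s gᵢ⁻¹ = 1 + σ with σσ' = 0, so
(1+σ)(1+σ')⁻¹ = 1 + σ − σ' and the six-fold product is 1 + Σ(σ−σ')). [difficulty: provable-now] -/
@[route_item "route-MatrixMultiplication-HenselBoxCollapse"]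
def BoxToAbelianTransfer : Prop :=
  ∀ (p k m n a b c : ℕ), Nat.Prime p → m < k → k ≤ 2 * m → ∀ (g₁ g₂ g₃ : Matrix.GeneralLinearGroup (Fin n) (ZMod (p ^ k))) (D₁ : (Fin a → ZMod (p ^ k)) →ₗ[ZMod (p ^ k)] Matrix (Fin n) (Fin n) (ZMod (p ^ k))) (D₂ : (Fin b → ZMod (p ^ k)) →ₗ[ZMod (p ^ k)] Matrix (Fin n) (Fin n) (ZMod (p ^ k))) (D₃ : (Fin c → ZMod (p ^ k)) →ₗ[ZMod (p ^ k)] Matrix (Fin n) (Fin n) (ZMod (p ^ k))) (S T U : Finset (Matrix.GeneralLinearGroup (Fin n) (ZMod (p ^ k)))), (∀ s ∈ S, ∃ x, (s : Matrix (Fin n) (Fin n) (ZMod (p ^ k))) = g₁.val * (1 + ((p : ZMod (p ^ k)) ^ m) • D₁ x)) → (∀ t ∈ T, ∃ y, (t : Matrix (Fin n) (Fin n) (ZMod (p ^ k))) = g₂.val * (1 + ((p : ZMod (p ^ k)) ^ m) • D₂ y)) → (∀ u ∈ U, ∃ z, (u : Matrix (Fin n) (Fin n) (ZMod (p ^ k)))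 = g₃.val * (1 + ((p : ZMod (p ^ k)) ^ m) • D₃ z)) → Literature.Combinatorics.Additive.TripleProductProperty S T U → ∃ S' T' U' : Finset (Matrix (Fin n) (Fin n) (ZMod (p ^ k))), S'.card = S.card ∧ T'.card = T.card ∧ U'.card = U.card ∧ Literature.Combinatorics.Additive.AddTripleProductProperty S' T' U' ∧ (∀ σ ∈ S', ∃ x, σ = ((p : ZMod (p ^ k)) ^ m) • (g₁.val * D₁ x * g₁⁻¹.val : Matrix (Fin n) (Fin n) (ZMod (p ^ k)))) ∧ (∀ τ ∈ T', ∃ y, τ = ((p : ZMod (p ^ k)) ^ m) • (g₂.val * D₂ y * g₂⁻¹.val : Matrix (Fin n) (Fin n) (ZMod (p ^ k)))) ∧ (∀ υ ∈ U', ∃ z, υ = ((p : ZMod (p ^ k)) ^ m) • (g₃.val * D₃ z * g₃⁻¹.val : Matrix (Fin n) (Fin n) (ZMod (p ^ k))))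

/-- item stmt-MatrixMultiplication-6817 · support · rank 9 · closed · moot by None · by planner
sources: CohnUmans2003, arXiv:2602.15796, Neumann2011
[support] (CohnUmans2003 Lemma 3.1, additive Finset form, provable now) in an abelian group an
additive TPP triple has injective sum map: if s + t + u ∈ V for all s ∈ S, t ∈ T, u ∈ U then
|S||T||U| ≤ |V|. [difficulty: provable-now] -/
@[route_item "route-MatrixMultiplication-HenselBoxCollapse"]
def AbelianTPPCapacity : Prop :=
  ∀ (H : Type) [AddCommGroup H] [DecidableEq H] (S T U V : Finset H), Literature.Combinatorics.Additive.AddTripleProductProperty S T U → (∀ s ∈ S, ∀ t ∈ T, ∀ u ∈ U, s + t + u ∈ V) → S.card * T.card * U.card ≤ V.card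

/-- item stmt-MatrixMultiplication-6818 · support · rank 9 · closed · moot by None · by planner
sources: BlasiakCohnGrochowPrattUmans2023, CohnUmans2003, arXiv:2410.14905
[support] (the card's "collapse lemma", provable now from the target) with injective Dᵢ and FULL
boxes gᵢ(1 + p^m Dᵢ(R^aᵢ)) ⊆ S, T, U (sizes p^((k−m)aᵢ)), TPP forces a + b + c ≤ d: reductions mod
p^k (k ≥ 2) of p-adic analytic TPP submanifolds of a d-dimensional group can stay TPP only if their
conjugated tangent spaces are independent — no excess, unlike ℝ (CU03 arXiv-text Thm 12 / BCGPU23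
Thm 4.10) and unlike ℚ_p itself ((U⁺,U⁻,SO(q)) ⊂ SL₄(ℚ_p)). [difficulty: provable-now] -/
@[route_item "route-MatrixMultiplication-HenselBoxCollapse"]
def FullBoxCollapse : Prop :=
  ∀ (p k m n a b c d : ℕ), Nat.Prime p → m < k → k ≤ 2 * m → ∀ (g₁ g₂ g₃ : Matrix.GeneralLinearGroup (Fin n) (ZMod (p ^ k))) (D₁ : (Fin a → ZMod (p ^ k)) →ₗ[ZMod (p ^ k)] Matrix (Fin n) (Fin n) (ZMod (p ^ k))) (D₂ : (Fin b → ZMod (p ^ k)) →ₗ[ZMod (p ^ k)] Matrix (Fin n) (Fin n) (ZMod (p ^ k))) (D₃ : (Fin c → ZMod (p ^ k)) →ₗ[ZMod (p ^ k)] Matrix (Fin n) (Fin n) (ZMod (p ^ k))) (gen : Fin d → Matrix (Fin n) (Fin n) (ZMod (p ^ k))), (∀ x, D₁ x = 0 → x = 0) → (∀ y, D₂ y = 0 → y = 0) → (∀ z, D₃ z = 0 → z = 0) → (∀ x, (g₁.val * D₁ x * g₁⁻¹.val : Matrix (Fin n) (Fin n) (ZMod (p ^ k))) ∈ Submodule.span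 (ZMod (p ^ k)) (Set.range gen)) → (∀ y, (g₂.val * D₂ y * g₂⁻¹.val : Matrix (Fin n) (Fin n) (ZMod (p ^ k))) ∈ Submodule.span (ZMod (p ^ k)) (Set.range gen)) → (∀ z, (g₃.val * D₃ z * g₃⁻¹.val : Matrix (Fin n) (Fin n) (ZMod (p ^ k))) ∈ Submodule.span (ZMod (p ^ k)) (Set.range gen)) → ∀ (S T U : Finset (Matrix.GeneralLinearGroup (Fin n) (ZMod (p ^ k)))), (∀ x, ∃ s ∈ S, (s : Matrix (Fin n) (Fin n) (ZMod (p ^ k))) = g₁.val * (1 + ((p : ZMod (p ^ k)) ^ m) • D₁ x)) → (∀ y, ∃ t ∈ T, (t : Matrix (Fin n) (Fin n) (ZMod (p ^ k))) = g₂.val * (1 + ((p : ZMod (p ^ k)) ^ m) • D₂ y)) → (∀ z, ∃ u ∈ U, (u : Matrix (Fin n) (Fin n) (ZMod (p ^ k))) = g₃.val * (1 + ((p : ZMod (p ^ k)) ^ m) • D₃ z)) → Literature.Combinatorics.Additive.TripleProductProperty S T U → a + b + c ≤ d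

/-- item stmt-MatrixMultiplication-6819 · assembly · rank 1 · closed · moot by None · by planner
sources: CohnUmans2003, Neumann2011
[assembly] BoxToAbelianTransfer → AbelianTPPCapacity → AnalyticBoxBarrier (conclusion = the
barrier). -/
@[route_item "route-MatrixMultiplication-HenselBoxCollapse"]
def Assembly : Prop :=
  BoxToAbelianTransfer → AbelianTPPCapacity → AnalyticBoxBarrier

end Summit.MatrixMultiplication.MatrixMultiplication.Theses.HenselBoxCollapse
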